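import Summits.RiemannHypothesis.RiemannHypothesis.Theorems.GroundBartaPolarPerronFrobeniusRobustSignDominance
import HarnessLib

/-!
# The robust crux in ROUTE FORM (inline Mathlib-primitive spelling) closes route GroundBarta
(crux `PolarPerronFrobenius`, stmt-RiemannHypothesis-18390; restatement candidate — RH-free)

Route `RiemannHypothesis/GroundBarta` states its items over Mathlib primitives (rev 1, cone-free:
`IsWeilTest ↦ ContDiff ∧ HasCompactSupport`, `weilQuadratic ↦` the inline `Q`, ground states in
the junk-free `∀ h ∀ δ ∀ᶠ n` encoding).  This file spells the MASS FORM of the robust twin of crux #3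
in exactly that style — the hypothesis `hDom` of
`riemannHypothesis_of_signDominantPolarPerronFrobenius_routeForm` below is a candidate BODY for a
restated item `PolarPerronFrobenius` (Riemann's kernel enters as
`Φ t = 2 · deBruijnPhi (t/2)`, the definitional unfolding of `weilThetaPhi`; `deBruijnPhi` lives in the
conjecture-free module `Literature.NumberTheory.LFunctions.DeBruijnNewman`) — and proves that it,
together with item #4 `EvenWinsBeyondArch` (verbatim), implies `RiemannHypothesis`.  So after a
`route edit --restate` with this body the deciding theorem `closes` is the one-liner
`riemannHypothesis_of_signDominantPolarPerronFrobenius_routeForm hPF hEven` (items #2, #9 are then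
consumed inside the proved theorem).  The translation is definitional for `Q`, `IsWeilTest`, `Φ`, and
the landed equivalence `PolarPerronFrobenius.isWeilGroundState_iff_forall_eventually_le` for the
ground-state clause.  RH-free; no definitions.
-/

set_option linter.dupNamespace false

noncomputable section

open Set MeasureTheory Filter Complex
open scoped Real Topology ComplexConjugate

namespace Summit.RiemannHypothesis.RiemannHypothesis.Theorems.GroundBartaFloor

open Literature.NumberTheory.LFunctions

/-- **Route-form deciding theorem for the robust (mass-form) crux.**  With
`Φ t = 2·deBruijnPhi(t/2)` (Riemann's kernel, `Φ̂ = ξ`) and `Q` Weil's windowed quadratic form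
spelled over Mathlib primitives as in the route items: IF beyond every height there is a window `a`
at which, whenever the even sector carries the bottom, some ground state `u` of the full form
(junk-free encoding) has `Im u = 0` a.e. on `(-a,a)`, `∫ (Re u)⁻Φ ≤ (1/3)∫ (Re u)⁺Φ` and
`∫ (Re u)⁺Φ ≥ exp(−e^{a})` (`(Re u)^± = max(±𝟙_{(-a,a)}Re u, 0)`), THEN `EvenWinsBeyondArch` implies the
Riemann Hypothesis. [cite: Bombieri2000Weil, §4; Yoshida1992HermitianForms, Prop. 1(1)] -/
theorem riemannHypothesis_of_signDominantPolarPerronFrobenius_routeForm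
    (hDom :
      let C : (ℝ → ℂ) → ℝ → ℂ := fun g => MeasureTheory.convolution g
        (fun t => (starRingEnd ℂ) (g (-t))) (ContinuousLinearMap.mul ℂ ℂ)
        MeasureTheory.MeasureSpace.volume
      let M : (ℝ → ℂ) → ℂ → ℂ := fun F s => ∫ t : ℝ, F t * Complex.exp ((s - 1 / 2) * t)
      let Q : (ℝ → ℂ) → ℂ := fun g => M (C g) 0 + M (C g) 1 -
        (∑' n : ℕ, ((ArithmeticFunction.vonMangoldt n : ℝ) : ℂ) / (Real.sqrt n : ℂ) *
          (C g (Real.log n) + C g (-Real.log n))) +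
        ((1 / (2 * Real.pi) : ℂ) * (∫ t : ℝ, M (C g) (1 / 2 + t * Complex.I) *
          ((Complex.digamma (1 / 4 + t / 2 * Complex.I)).re : ℂ)) - C g 0 * (Real.log Real.pi : ℂ))
      let Φ : ℝ → ℝ := fun t => 2 * Literature.NumberTheory.LFunctions.deBruijnPhi (t / 2)
      ∀ A : ℝ, ∃ a : ℝ, A ≤ a ∧
        ((∀ o : ℝ → ℂ, (ContDiff ℝ ((⊤ : ℕ∞) : WithTop ℕ∞) o ∧ HasCompactSupport o) →
            tsupport o ⊆ Set.Icc (-a) a → (∀ t, o (-t) = -o t) → ∫ t, ‖o t‖ ^ 2 = (1 : ℝ) →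
            ∀ δ : ℝ, 0 < δ → ∃ w : ℝ → ℂ, (ContDiff ℝ ((⊤ : ℕ∞) : WithTop ℕ∞) w ∧
              HasCompactSupport w) ∧ tsupport w ⊆ Set.Icc (-a) a ∧ (∀ t, w (-t) = w t) ∧
              ∫ t, ‖w t‖ ^ 2 = (1 : ℝ) ∧ (Q w).re ≤ (Q o).re + δ) →
          ∃ u : ℝ → ℂ, (MeasureTheory.MemLp u 2 ∧ ∃ g : ℕ → ℝ → ℂ,
              (∀ n, (ContDiff ℝ ((⊤ : ℕ∞) : WithTop ℕ∞) (g n) ∧ HasCompactSupport (g n)) ∧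
                tsupport (g n) ⊆ Set.Icc (-a) a ∧ ∫ t, ‖g n t‖ ^ 2 = (1 : ℝ)) ∧
              (∀ h : ℝ → ℂ, (ContDiff ℝ ((⊤ : ℕ∞) : WithTop ℕ∞) h ∧ HasCompactSupport h) →
                tsupport h ⊆ Set.Icc (-a) a → ∫ t, ‖h t‖ ^ 2 = (1 : ℝ) → ∀ δ : ℝ, 0 < δ →
                  ∀ᶠ n in Filter.atTop, (Q (g n)).re ≤ (Q h).re + δ) ∧
              Filter.Tendsto (fun n => ∫ t, ‖g n t - u t‖ ^ 2) Filter.atTop (nhds 0)) ∧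
            (∀ᵐ t : ℝ, t ∈ Set.Ioo (-a) a → (u t).im = 0) ∧
            (∫ t, max (-(Set.Ioo (-a) a).indicator (fun t => (u t).re) t) 0 * Φ t) ≤
              (1 / 3) * (∫ t, max ((Set.Ioo (-a) a).indicator (fun t => (u t).re) t) 0 * Φ t) ∧
            Real.exp (-Real.exp a) ≤
              (∫ t, max ((Set.Ioo (-a) a).indicator (fun t => (u t).re) t) 0 * Φ t)))
    (hEven : Summit.RiemannHypothesis.RiemannHypothesis.Theses.GroundBarta.EvenWinsBeyondArch) :
    RiemannHypothesis := by
  refine riemannHypothesis_of_signDominantPolarPerronFrobenius (fun A => ?_) hEven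
  obtain ⟨a, ha, hmat⟩ := hDom A
  refine ⟨a, ha, fun hEW => ?_⟩
  obtain ⟨u, hu, hreal, hneg, hpos⟩ := hmat hEW
  have hu' : IsWeilGroundState a u :=
    (PolarPerronFrobenius.isWeilGroundState_iff_forall_eventually_le a u).2 hu
  -- `Φ t = 2·deBruijnPhi(t/2)` is `weilThetaPhi t` by definition (`weilThetaPhi_def`)
  exact ⟨u, hu', hreal, hneg, hpos⟩

end Summit.RiemannHypothesis.RiemannHypothesis.Theorems.GroundBartaFloor

end
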